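import Summits.KontsevichZagierPeriods.KontsevichZagierPeriods.Theses.HurwitzMicroSectors
import Summits.KontsevichZagierPeriods.KontsevichZagierPeriods.Theorems.HurwitzMicroSectorsNormalFormPrinciplePiBoxTransfer
import Summits.KontsevichZagierPeriods.KontsevichZagierPeriods.Theorems.HurwitzMicroSectorsNormalFormPrincipleVariants2239
import Summits.KontsevichZagierPeriods.KontsevichZagierPeriods.Theorems.HurwitzMicroSectorsNormalFormPrincipleVariants2274
import Summits.KontsevichZagierPeriods.KontsevichZagierPeriods.Theorems.HurwitzMicroSectorsNormalFormPrincipleVariants2275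

/-! TTRL-lite variant V2276 of stmt-KontsevichZagierPeriods-3869

Variant V2276 = `stub_boxRigidity` (the leaf `BoxRigidity` of `NormalFormPrinciple`: two BOX-RATIONAL
representations — domain the open unit box, integrand `p/q` with `p, q` over `ℚ`, `q ≠ 0` on the box —
with equal values are KZ-equivalent) under the JOINT bound `bound_nat:m≤4; bound_nat:m'≤5`. Verdict of
the attempt seat: **open** — this file is the exact-strength certificate, not a proof of the variant.
A joint bound pins the leaf to one dimension (`boxRigidityLe_iff_boxVanishing`, file `…Variants2239`,
instance `j = 4, k = 5`, `max 4 5 = 5`): V2276 is EXACTLY BoxVanishing in dimension `5` — every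
box-rational representation on `(0,1)⁵` of value `0` is a KZ relation
(`stub_boxRigidity_var2276_iff_boxVanishing_five`; forward: compare a vanishing representation on
`(0,1)⁵`, right slot `m' = 5`, with the zero representation on the `0`-box, left slot `m = 0 ≤ 4`;
backward: pad both representations to `(0,1)⁵` by unit intervals and subtract there). Equivalently
BoxRigidity under the symmetric bound `m, m' ≤ 5` (`stub_boxRigidity_var2276_iff_le_five`), and the
same statement as the siblings V2274 (`fix m=4; fix m'=5`) and V2275 (`fix m=4; bound m'≤5`)
(`stub_boxRigidity_var2276_iff_var2274`, `stub_boxRigidity_var2276_iff_var2275`); it gives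
BoxVanishing in every dimension `≤ 5` (`boxVanishing_le_five_of_stub_boxRigidity_var2276`).
BoxVanishing `5` is Conjecture 1 of Kontsevich–Zagier in kernel form for all `ℚ`-rational absolutely
convergent `∫_{(0,1)^5} p/q` (`ζ(5)`, `ζ(3)`, `π²`, `π⁴`, Catalan's `G`, `Li_k` at rationals, …); already
its dimension-`2` consequence asks, for every `a, b ∈ ℚ`, that `a − b·G = 0` force a chain of moves —
undecidable today without the (open) irrationality of `G`; the tree proves only dimension `≤ 1`
(`boxRigidity_of_le_one`, Baker). Conversely `KontsevichZagierPeriods ⇒ parent ⇒ V2276`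
(`stub_boxRigidity_var2276_of_parent`, `stub_boxRigidity_var2276_of_statement`), so a refutation of
the variant would refute the Summit, and no invariant of `KZ.relations` finer than `eval` is known
(soundness `relations_le_ker_eval_holds` is the only one in the tree).
Source: M. Kontsevich, D. Zagier, *Periods* (2001), §1.2 Conjecture 1. Pure proof file, no definitions. -/

-- `Summit.<Summit>.<Problem>` is the tree's mandated summit-side namespace (CONVENTIONS §2); for this
-- single-conjunct summit the two coincide, so the duplicate is deliberate.
set_option linter.dupNamespace false

noncomputable section

namespace Summit.KontsevichZagierPeriods.KontsevichZagierPeriods.Theorems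

open MeasureTheory Set
open Literature.NumberTheory.Transcendental Literature.NumberTheory.Transcendental.KZ
open Summit.KontsevichZagierPeriods.KontsevichZagierPeriods.Theses.HurwitzMicroSectors
open Summit.KontsevichZagierPeriods.HurwitzMicroSectors.NormalFormPrinciple.PiBox

/-! ## The variant V2276: exactly `BoxVanishing 5` -/

/-- **V2276 ⟺ BoxVanishing in dimension `5`** (every box-rational representation on `(0,1)⁵` of
value `0` is a KZ relation): instance `j = 4, k = 5` of `boxRigidityLe_iff_boxVanishing`
(`max 4 5 = 5`). [cite: KontsevichZagier2001, §1.2 Conjecture 1] -/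
theorem stub_boxRigidity_var2276_iff_boxVanishing_five :
    (∀ (m m' : ℕ) (N : IntegralRep m) (N' : IntegralRep m'), m' ≤ 5 → m ≤ 4 → N.domain = {x | ∀ i, x i ∈ Set.Ioo (0:ℝ) 1} → N.IsRational → N'.domain = {x | ∀ i, x i ∈ Set.Ioo (0:ℝ) 1} → N'.IsRational → N.value = N'.value → Equivalent N N') ↔
    (∀ (M : IntegralRep 5), M.domain = {x | ∀ i, x i ∈ Set.Ioo (0:ℝ) 1} → M.IsRational →
      M.value = 0 → of M ∈ relations) :=
  boxRigidityLe_iff_boxVanishing 4 5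

/-- **V2276 ⟺ BoxRigidity under the symmetric bound `m, m' ≤ 5`** (the honest strength of the
variant: the bound `m ≤ 4` may be relaxed to `m ≤ 5` for free, by padding).
[cite: KontsevichZagier2001, §1.2 Conjecture 1] -/
theorem stub_boxRigidity_var2276_iff_le_five :
    (∀ (m m' : ℕ) (N : IntegralRep m) (N' : IntegralRep m'), m' ≤ 5 → m ≤ 4 → N.domain = {x | ∀ i, x i ∈ Set.Ioo (0:ℝ) 1} → N.IsRational → N'.domain = {x | ∀ i, x i ∈ Set.Ioo (0:ℝ) 1} → N'.IsRational → N.value = N'.value → Equivalent N N') ↔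
    (∀ (m m' : ℕ) (N : IntegralRep m) (N' : IntegralRep m'), m ≤ 5 → m' ≤ 5 →
      N.domain = {x | ∀ i, x i ∈ Set.Ioo (0:ℝ) 1} → N.IsRational →
      N'.domain = {x | ∀ i, x i ∈ Set.Ioo (0:ℝ) 1} → N'.IsRational →
      N.value = N'.value → Equivalent N N') := by
  rw [stub_boxRigidity_var2276_iff_boxVanishing_five]
  exact ⟨fun hvan m m' N N' hm hm' => boxRigidityLe_of_boxVanishing (j := 5) (k := 5) le_rfl le_rfl
      hvan m m' N N' hm' hm,
    fun h => boxVanishing_of_boxRigidityLe (j := 5) (k := 5) le_rfl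
      fun m m' N N' hm' hm => h m m' N N' hm hm'⟩

/-- **V2276 ⟺ the sibling V2274** (`fix_nat:m=4; fix_nat:m'=5`): both are BoxVanishing `5`.
[cite: KontsevichZagier2001, §1.2 Conjecture 1] -/
theorem stub_boxRigidity_var2276_iff_var2274 :
    (∀ (m m' : ℕ) (N : IntegralRep m) (N' : IntegralRep m'), m' ≤ 5 → m ≤ 4 → N.domain = {x | ∀ i, x i ∈ Set.Ioo (0:ℝ) 1} → N.IsRational → N'.domain = {x | ∀ i, x i ∈ Set.Ioo (0:ℝ) 1} → N'.IsRational → N.value = N'.value → Equivalent N N') ↔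
    (∀ (N : IntegralRep 4) (N' : IntegralRep 5), N.domain = {x | ∀ i, x i ∈ Set.Ioo (0:ℝ) 1} → N.IsRational → N'.domain = {x | ∀ i, x i ∈ Set.Ioo (0:ℝ) 1} → N'.IsRational → N.value = N'.value → Equivalent N N') := by
  rw [stub_boxRigidity_var2276_iff_boxVanishing_five, stub_boxRigidity_var2274_iff_boxVanishing_five]

/-- **V2276 ⟺ the sibling V2275** (`fix_nat:m=4; bound_nat:m'≤5`): both are BoxVanishing `5`.
[cite: KontsevichZagier2001, §1.2 Conjecture 1] -/
theorem stub_boxRigidity_var2276_iff_var2275 :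
    (∀ (m m' : ℕ) (N : IntegralRep m) (N' : IntegralRep m'), m' ≤ 5 → m ≤ 4 → N.domain = {x | ∀ i, x i ∈ Set.Ioo (0:ℝ) 1} → N.IsRational → N'.domain = {x | ∀ i, x i ∈ Set.Ioo (0:ℝ) 1} → N'.IsRational → N.value = N'.value → Equivalent N N') ↔
    (∀ (m' : ℕ) (N : IntegralRep 4) (N' : IntegralRep m'), m' ≤ 5 → N.domain = {x | ∀ i, x i ∈ Set.Ioo (0:ℝ) 1} → N.IsRational → N'.domain = {x | ∀ i, x i ∈ Set.Ioo (0:ℝ) 1} → N'.IsRational → N.value = N'.value → Equivalent N N') := by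
  rw [stub_boxRigidity_var2276_iff_boxVanishing_five, stub_boxRigidity_var2275_iff_boxVanishing_five]

/-- **V2276 ⇒ BoxVanishing in every dimension `≤ 5`** (monotonicity along padding,
`boxVanishing_mono`); the first open level is `2`. [cite: KontsevichZagier2001, §1.2 Conjecture 1] -/
theorem boxVanishing_le_five_of_stub_boxRigidity_var2276
    (h : ∀ (m m' : ℕ) (N : IntegralRep m) (N' : IntegralRep m'), m' ≤ 5 → m ≤ 4 → N.domain = {x | ∀ i, x i ∈ Set.Ioo (0:ℝ) 1} → N.IsRational → N'.domain = {x | ∀ i, x i ∈ Set.Ioo (0:ℝ) 1} → N'.IsRational → N.value = N'.value → Equivalent N N')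
    {j : ℕ} (hj : j ≤ 5) (N : IntegralRep j) (hNd : N.domain = {x | ∀ i, x i ∈ Set.Ioo (0:ℝ) 1})
    (hNr : N.IsRational) (hv : N.value = 0) : of N ∈ relations :=
  boxVanishing_mono hj (stub_boxRigidity_var2276_iff_boxVanishing_five.1 h) N hNd hNr hv

/-- **BoxVanishing `5` ⇒ V2276** (the form in which a future proof of the dimension-`5` kernel
statement would be consumed). [cite: KontsevichZagier2001, §1.2 Conjecture 1] -/
theorem stub_boxRigidity_var2276_of_boxVanishing_five
    (hvan : ∀ (M : IntegralRep 5), M.domain = {x | ∀ i, x i ∈ Set.Ioo (0:ℝ) 1} → M.IsRational →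
      M.value = 0 → of M ∈ relations) :
    ∀ (m m' : ℕ) (N : IntegralRep m) (N' : IntegralRep m'), m' ≤ 5 → m ≤ 4 → N.domain = {x | ∀ i, x i ∈ Set.Ioo (0:ℝ) 1} → N.IsRational → N'.domain = {x | ∀ i, x i ∈ Set.Ioo (0:ℝ) 1} → N'.IsRational → N.value = N'.value → Equivalent N N' :=
  stub_boxRigidity_var2276_iff_boxVanishing_five.2 hvan

/-- **The parent leaf ⇒ V2276** (drop both bounds). [cite: KontsevichZagier2001, §1.2 Conjecture 1] -/
theorem stub_boxRigidity_var2276_of_parent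
    (h : ∀ (m m' : ℕ) (N : IntegralRep m) (N' : IntegralRep m'), N.domain = {x | ∀ i, x i ∈ Set.Ioo (0:ℝ) 1} → N.IsRational → N'.domain = {x | ∀ i, x i ∈ Set.Ioo (0:ℝ) 1} → N'.IsRational → N.value = N'.value → Equivalent N N') :
    ∀ (m m' : ℕ) (N : IntegralRep m) (N' : IntegralRep m'), m' ≤ 5 → m ≤ 4 → N.domain = {x | ∀ i, x i ∈ Set.Ioo (0:ℝ) 1} → N.IsRational → N'.domain = {x | ∀ i, x i ∈ Set.Ioo (0:ℝ) 1} → N'.IsRational → N.value = N'.value → Equivalent N N' :=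
  fun m m' N N' _ _ => h m m' N N'

/-- **`KontsevichZagierPeriods ⇒ V2276`**: the variant is a special case of Conjecture 1 for the
tree's calculus (`leaves_of_statement`) — so a refutation of the variant would refute the Summit.
[cite: KontsevichZagier2001, §1.2 Conjecture 1] -/
theorem stub_boxRigidity_var2276_of_statement (h : _root_.KontsevichZagierPeriods) :
    ∀ (m m' : ℕ) (N : IntegralRep m) (N' : IntegralRep m'), m' ≤ 5 → m ≤ 4 → N.domain = {x | ∀ i, x i ∈ Set.Ioo (0:ℝ) 1} → N.IsRational → N'.domain = {x | ∀ i, x i ∈ Set.Ioo (0:ℝ) 1} → N'.IsRational → N.value = N'.value → Equivalent N N' :=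
  stub_boxRigidity_var2276_of_parent (leaves_of_statement h).1

end Summit.KontsevichZagierPeriods.KontsevichZagierPeriods.Theorems

end
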